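import Literature.Analysis.FluidPDE.TaoSingleScaleGeometry
import Literature.Analysis.FluidPDE.TaoWeightedFormSlot
import HarnessLib

/-!
# Tao 2016, §3.4 proved: the cascade operator from its single-scale piece (`cascade_of_singleScale`)

T. Tao, *Finite time blowup for an averaged three-dimensional Navier–Stokes equation*,
J. Amer. Math. Soc. **29** (2016), 601–674 = arXiv:1402.0290v3 (held as `paper:arxiv-1402.0290`),
§3.4 "Fourth step: localising to a single frequency scale", pp. 16–17. This file discharges the
named fact `Literature.Analysis.FluidPDE.Tao2016.cascade_of_singleScale`
(`TaoAveragedCascadeSteps.lean`): **if `C₀` (3.8) is a dilation-free complex average (3.9) of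
`B_{η,ρ,0}`, then the complexified basic cascade operator `C` (3.6) with normalised profiles (3.7)
is a complex average of `B_{η,ρ}`**, for `0 < ε₀ ≤ 1/100` (`cascade_of_singleScale_holds`).

The printed argument (p. 17) and its rendering:

1. *"From the definition of `C₀` (and the support hypotheses on `ψ₁,ψ₂,ψ₃`), we see that we may
   smoothly localise each `m_{j,ω}` to the ball `B(ξⱼ⁰, O(ε₀³))` without loss of generality (and
   without destroying the fact that the `m_{i,ω}(D)` are Fourier multipliers of order `0` that obey
   (3.5))"* — the symbols are multiplied by the radial cut-offs `χⱼ = shellCutoff |ξⱼ⁰| (4ε₀³)`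
   (`= 1` on `B(ξⱼ⁰, ε₀³) ⊇ supp ψ̂ⱼ`, so `C₀(χ₁(D)u, χ₂(D)v, χ₃(D)w) = C₀(u,v,w)`,
   `singleScaleForm_fourierMultiplier`; radial cut-offs commute with the rotations). The localised
   symbols stay in `𝓜₀ ⊗ ℂ` (Leibniz) and obey (3.5) (`TaoSymbolLocalisation.lean`,
   `TaoSymbolSeminormMeasurable.lean`).
2. *"If we then define `m_{i,ω,n}(ξ) := m_{i,ω}((1+ε₀)^{-n}ξ)` and `m̃_{i,ω} := Σ_{n∈ℤ} m_{i,ω,n}`,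
   then the `m̃_{i,ω}(D)` are also Fourier multipliers of order `0` obeying (3.5)"* —
   `localisedSymbol ε₀ i m = periodise (1+ε₀) (m χᵢ)` and the complex averaging datum
   `ComplexAveragingDatum.singleScale` (same `(Ω,μ)`, same rotations, no dilations, symbols `m̃`).
3. *"the quantity `∫_Ω ⟨B_{η,ρ}(m_{1,ω,n₁}(D)Rot u, m_{2,ω,n₂}(D)Rot v), m_{3,ω,n₃}(D)Rot w⟩ dμ` is
   equal to `-πi⟨C_{n₁}(u,v),w⟩` when `n₁=n₂=n₃`, and vanishing otherwise if `ε₀` is small enough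
   (thanks to the support properties of `m_{i,ω,n}`, `η` and `ρ`)"* — organised here scale by
   scale of `ρ = Σₙ φₙ`: `⟨C_n(u,v),w⟩ = ∫_Ω ⟨B_{η,ρ,n}(m̃₁(D)Rot u, m̃₂(D)Rot v), m̃₃(D)Rot w⟩ dμ`
   (`cascadeTerm_eq_integral_singleScale`), by the two scaling laws of §3.4
   (`cascadeTerm_eq_singleScaleForm_dil`, `betaRhoScaleForm_eq_dil`), the hypothesis (3.9) at the
   dilated and truncated fields, the fact that `B_{η,ρ,0}` only sees the symbols on the thin shells
   `| |ξⱼ| - |ξⱼ⁰| | < 30ε₀²` where `m̃ⱼ = mⱼχⱼ` (`weightedForm_slot_localise`: this is where the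
   cross terms vanish), and the commutation of `m̃(D) Rot` with the dilations `Dil_{(1+ε₀)^{-n}}`
   (periodicity of `m̃`, `singleScale_slot_dil`).
4. *"Summing, we see that `⟨C(u,v),w⟩ = (1/(-πi)) ∫_Ω ⟨B_{η,ρ}(m̃₁(D)Rot u, m̃₂(D)Rot v), m̃₃(D)Rot w⟩ dμ`
   … (absorbing the `1/(-πi)` factor into `m_{1,ω}`)"* — `cplxBasicCascadeForm_eq_average`:
   `Σₙ` and `∫_Ω` are exchanged by the summed absolute bound of `TaoWeightedFormSlot.lean`, the
   scales are resummed inside by `weightedForm_tsum` (`Σₙ φₙ η = ρ η`, at most one scale active,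
   `TaoSingleScaleGeometry.lean`), and the factor is absorbed by `ComplexAveragingDatum.scale`.

## References

* T. Tao, J. Amer. Math. Soc. 29 (2016), 601–674, arXiv:1402.0290v3, §3.4 pp. 16–17 ((3.6)–(3.9)),
  Def. 3.4 p. 15. Key `Tao2016AveragedNS`.
-/

noncomputable section

open MeasureTheory Set Filter FourierTransform
open scoped ENNReal NNReal SchwartzMap ComplexConjugate

namespace Literature.Analysis.FluidPDE.Tao2016

/-- Local notation for physical / frequency space `ℝ³`. -/
local notation "ℝ³" => EuclideanSpace ℝ (Fin 3)
/-- Local notation for the complexified range `ℂ³`. -/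
local notation "ℂ³" => EuclideanSpace ℂ (Fin 3)

/-! ### The localised, periodised symbols `m̃` -/

/-- The radial cut-off of slot `i`: `χᵢ = χ_{|ξᵢ⁰|, 4ε₀³}`, equal to `1` on `B(ξᵢ⁰, ε₀³)` and supported
in the shell `{| |ξ|² - |ξᵢ⁰|² | < 8ε₀³}`. [cite: Tao2016AveragedNS, §3.4 p. 17] -/
def slotCutoff (ε₀ : ℝ) (i : Fin 3) (ξ : ℝ³) : ℂ := shellCutoff ‖xi0 i‖ (4 * ε₀ ^ 3) ξ

/-- **Tao's `m̃_{i,ω} = Σₙ m_{i,ω,n}` for the localised symbol**: `m ↦ Σₙ (m χᵢ)((1+ε₀)^{-n} ·)`. [cite: Tao2016AveragedNS, §3.4 p. 17] -/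
def localisedSymbol (ε₀ : ℝ) (i : Fin 3) (m : ℝ³ → ℂ) : ℝ³ → ℂ :=
  periodise (1 + ε₀) (fun ξ => m ξ * slotCutoff ε₀ i ξ)

/-- The cut-off of slot `i` is a complex order-`0` symbol. [cite: Tao2016AveragedNS, §3.4 p. 17] -/
theorem isComplexSymbol_slotCutoff {ε₀ : ℝ} (hε : 0 < ε₀) (i : Fin 3) : IsComplexSymbol (slotCutoff ε₀ i) :=
  isComplexSymbol_shellCutoff _ (by positivity)

/-- The cut-off symbol `m χᵢ` is supported in the admissible shell of slot `i`. [cite: Tao2016AveragedNS, §3.4 p. 17] -/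
theorem isShellSupported_mul_slotCutoff {ε₀ : ℝ} (hε : 0 < ε₀) (i : Fin 3) (m : ℝ³ → ℂ) :
    IsShellSupported (localInnerSq ‖xi0 i‖ ε₀) (localOuterSq ‖xi0 i‖ ε₀)
      (fun ξ => m ξ * slotCutoff ε₀ i ξ) :=
  isShellSupported_mul_shellCutoff m _ hε

/-- `1 < 1 + ε₀`. [folklore] -/
theorem one_lt_base {ε₀ : ℝ} (hε : 0 < ε₀) : 1 < 1 + ε₀ := by linarith

/-- The inner squared radius of slot `i` is positive. [folklore] -/
theorem localInnerSq_xi0_pos {ε₀ : ℝ} (hε : 0 < ε₀) (hε5 : ε₀ ≤ 1 / 5) (i : Fin 3) :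
    0 < localInnerSq ‖xi0 i‖ ε₀ :=
  localInnerSq_pos (one_le_norm_xi0 i) hε hε5

/-- The shell of slot `i` is admissible for periodisation: `B < (1+ε₀)² A`. [cite: Tao2016AveragedNS, §3.4 p. 17] -/
theorem localShell_xi0_lt {ε₀ : ℝ} (hε : 0 < ε₀) (hε5 : ε₀ ≤ 1 / 5) (i : Fin 3) :
    localOuterSq ‖xi0 i‖ ε₀ < (1 + ε₀) ^ 2 * localInnerSq ‖xi0 i‖ ε₀ :=
  localShell_lt (one_le_norm_xi0 i) hε hε5

/-- **The localised symbols are complex Fourier multipliers of order `0`** ("then the `m̃_{i,ω}(D)`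
are also Fourier multipliers of order `0`", §3.4). [cite: Tao2016AveragedNS, §3.4 p. 17] -/
theorem isComplexSymbol_localisedSymbol {ε₀ : ℝ} (hε : 0 < ε₀) (hε5 : ε₀ ≤ 1 / 5) (i : Fin 3)
    {m : ℝ³ → ℂ} (hm : IsComplexSymbol m) : IsComplexSymbol (localisedSymbol ε₀ i m) :=
  IsComplexSymbol.periodise (one_lt_base hε) (localInnerSq_xi0_pos hε hε5 i)
    (localShell_xi0_lt hε hε5 i) (isShellSupported_mul_slotCutoff hε i m)
    (hm.mul (isComplexSymbol_slotCutoff hε i))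

/-- **Seminorm bound for the localised symbols**:
`‖m̃‖_k ≤ ‖m χᵢ‖_k ≤ Σ_{j ≤ k} (k choose j) ‖m‖_j ‖χᵢ‖_{k-j}` (disjoint scales, then Leibniz). [cite: Tao2016AveragedNS, §3.2 p. 16 and §3.4 p. 17] -/
theorem symbolSeminorm_localisedSymbol_le {ε₀ : ℝ} (hε : 0 < ε₀) (hε5 : ε₀ ≤ 1 / 5) (i : Fin 3)
    {m : ℝ³ → ℂ} (hm : IsComplexSymbol m) (k : ℕ) :
    symbolSeminorm k (localisedSymbol ε₀ i m) ≤
      ∑ j ∈ Finset.range (k + 1), (k.choose j : ℝ≥0∞) *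
        (symbolSeminorm j m * symbolSeminorm (k - j) (slotCutoff ε₀ i)) :=
  (symbolSeminorm_periodise_le (one_lt_base hε) (localInnerSq_xi0_pos hε hε5 i)
    (localShell_xi0_lt hε hε5 i) (isShellSupported_mul_slotCutoff hε i m)
    (hm.mul (isComplexSymbol_slotCutoff hε i)).1 k).trans
    (symbolSeminorm_mul_le hm.1 (isComplexSymbol_slotCutoff hε i).1 k)

/-- The localised symbols of a measurable family are measurable (off the origin). [folklore] -/
theorem measurable_localisedSymbol {Ω : Type*} [MeasurableSpace Ω] {ε₀ : ℝ} (hε : 0 < ε₀)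
    (hε5 : ε₀ ≤ 1 / 5) (i : Fin 3) {m : Ω → ℝ³ → ℂ}
    (hmeas : ∀ ξ : ℝ³, ξ ≠ 0 → Measurable fun θ => m θ ξ) {ξ : ℝ³} (hξ : ξ ≠ 0) :
    Measurable fun θ => localisedSymbol ε₀ i (m θ) ξ :=
  measurable_periodise (one_lt_base hε) (localInnerSq_xi0_pos hε hε5 i) (localShell_xi0_lt hε hε5 i)
    (fun θ => isShellSupported_mul_slotCutoff hε i (m θ))
    (fun ζ hζ => (hmeas ζ hζ).mul measurable_const) hξ

/-- **Multiplicative periodicity of `m̃`**: `m̃((1+ε₀)ⁿ ξ) = m̃(ξ)`. [cite: Tao2016AveragedNS, §3.4 p. 17] -/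
theorem localisedSymbol_zpow_smul {ε₀ : ℝ} (hε : 0 < ε₀) (i : Fin 3) (m : ℝ³ → ℂ) (n : ℤ)
    (ξ : ℝ³) : localisedSymbol ε₀ i m ((1 + ε₀) ^ n • ξ) = localisedSymbol ε₀ i m ξ :=
  periodise_zpow_smul (by linarith : (1 + ε₀) ≠ 0) _ n ξ

/-- `m̃((1+ε₀)⁻ⁿ ξ) = m̃(ξ)`. [cite: Tao2016AveragedNS, §3.4 p. 17] -/
theorem localisedSymbol_zpow_inv_smul {ε₀ : ℝ} (hε : 0 < ε₀) (i : Fin 3) (m : ℝ³ → ℂ) (n : ℤ)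
    (ξ : ℝ³) : localisedSymbol ε₀ i m (((1 + ε₀) ^ n)⁻¹ • ξ) = localisedSymbol ε₀ i m ξ :=
  periodise_zpow_inv_smul (by linarith : (1 + ε₀) ≠ 0) _ n ξ

/-- **On the thin shell `| |ξ| - |ξᵢ⁰| | < 30ε₀²` the localised symbol is `m χᵢ`** (`0 < ε₀ ≤ 1/100`:
the shell lies in the fundamental scale shell). [cite: Tao2016AveragedNS, §3.4 p. 17] -/
theorem localisedSymbol_eq_of_mem_normShell {ε₀ : ℝ} (hε : 0 < ε₀) (hε1 : ε₀ ≤ 1 / 100) (i : Fin 3)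
    (m : ℝ³ → ℂ) {ξ : ℝ³} (hξ : ξ ∈ normShell ‖xi0 i‖ (30 * ε₀ ^ 2)) :
    localisedSymbol ε₀ i m ξ = m ξ * slotCutoff ε₀ i ξ := by
  obtain ⟨h1, h2⟩ := normShell_subset_fundamental (one_le_norm_xi0 i) (norm_xi0_le_three_halves i)
    hε hε1 hξ
  exact periodise_eq_self (one_lt_base hε) (isShellSupported_mul_slotCutoff hε i m) h1 h2

/-- The slot cut-off is radial. [folklore] -/
theorem slotCutoff_linearIsometryEquiv (ε₀ : ℝ) (i : Fin 3) (R : ℝ³ ≃ₗᵢ[ℝ] ℝ³) (ξ : ℝ³) :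
    slotCutoff ε₀ i (R ξ) = slotCutoff ε₀ i ξ :=
  shellCutoff_linearIsometryEquiv _ _ R ξ

/-- The slot cut-off equals `1` on the ball `B(ξᵢ⁰, ε₀³)` carrying `ψ̂ᵢ` (`0 < ε₀ ≤ 1`). [cite: Tao2016AveragedNS, §3.4 p. 17] -/
theorem slotCutoff_eq_one {ε₀ : ℝ} (hε : 0 < ε₀) (hε1 : ε₀ ≤ 1) (i : Fin 3) {ξ : ℝ³}
    (hξ : ξ ∈ Metric.closedBall (xi0 i) (ε₀ ^ 3)) : slotCutoff ε₀ i ξ = 1 :=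
  shellCutoff_eq_one_of_mem_closedBall (norm_nonneg _) (norm_xi0_le_three_halves i) hε hε1 rfl hξ

/-- The `L^∞` class of the slot cut-off, `χᵢ(D)` being the corresponding Fourier projection. [folklore] -/
def slotCutoffLp {ε₀ : ℝ} (hε : 0 < ε₀) (i : Fin 3) : Lp ℂ ∞ (volume : Measure ℝ³) :=
  ((isComplexSymbol_shellCutoff ‖xi0 i‖ (by positivity : (0 : ℝ) < 4 * ε₀ ^ 3)).memLp_top).toLp
    (slotCutoff ε₀ i)

/-- `slotCutoffLp = slotCutoff` a.e. [folklore] -/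
theorem coeFn_slotCutoffLp {ε₀ : ℝ} (hε : 0 < ε₀) (i : Fin 3) :
    (slotCutoffLp hε i : ℝ³ → ℂ) =ᵐ[volume] slotCutoff ε₀ i :=
  MemLp.coeFn_toLp _

/-- `slotCutoffLp = 1` a.e. on the ball `B(ξᵢ⁰, ε₀³)`. [cite: Tao2016AveragedNS, §3.4 p. 17] -/
theorem slotCutoffLp_eq_one_on_ball {ε₀ : ℝ} (hε : 0 < ε₀) (hε1 : ε₀ ≤ 1) (i : Fin 3) :
    ∀ᵐ ξ ∂(volume : Measure ℝ³), ξ ∈ Metric.closedBall (xi0 i) (ε₀ ^ 3) →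
      (slotCutoffLp hε i : ℝ³ → ℂ) ξ = 1 := by
  filter_upwards [coeFn_slotCutoffLp hε i] with ξ hξ hmem
  rw [hξ]
  exact slotCutoff_eq_one hε hε1 i hmem

/-! ### The single-scale datum: same `(Ω, μ)`, same rotations, no dilations, symbols `m̃` -/

namespace ComplexAveragingDatum

variable (𝒟 : ComplexAveragingDatum)

/-- The constants of the Leibniz bound for slot `i`: `(k choose j) ‖χᵢ‖_{k-j}` (finite). [folklore] -/
def leibnizConst (ε₀ : ℝ) (i : Fin 3) (k j : ℕ) : ℝ≥0∞ :=
  (k.choose j : ℝ≥0∞) * symbolSeminorm (k - j) (slotCutoff ε₀ i)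

/-- The Leibniz constants are finite. [folklore] -/
theorem leibnizConst_lt_top {ε₀ : ℝ} (hε : 0 < ε₀) (i : Fin 3) (k j : ℕ) :
    leibnizConst ε₀ i k j < ∞ :=
  ENNReal.mul_lt_top (by simp) ((isComplexSymbol_slotCutoff hε i).2 _)

/-- **The integrability conditions (3.5) survive localisation and periodisation**: for all
`k₁ k₂ k₃`, `∫_Ω ‖m̃₁‖_{k₁} ‖m̃₂‖_{k₂} ‖m̃₃‖_{k₃} dμ < ∞` ("without destroying the fact that the
`m_{i,ω}(D)` … obey (3.5)"; by the seminorm bound, expanding the product of the three Leibniz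
sums, the measurability of `ω ↦ ‖m_{i,ω}‖_j` and (3.5) for every triple of indices). [cite: Tao2016AveragedNS, §3.4 p. 17] -/
theorem lintegral_localisedSymbol_lt_top {ε₀ : ℝ} (hε : 0 < ε₀) (hε5 : ε₀ ≤ 1 / 5) (k : Fin 3 → ℕ) :
    ∫⁻ θ, ∏ i, symbolSeminorm (k i) (localisedSymbol ε₀ i (𝒟.m i θ)) ∂𝒟.μ < ∞ := by
  -- pointwise: product of the three Leibniz sums, expanded
  set t : Fin 3 → Finset ℕ := fun i => Finset.range (k i + 1) with ht
  set f : ∀ i : Fin 3, ℕ → 𝒟.Ω → ℝ≥0∞ := fun i j θ =>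
    leibnizConst ε₀ i (k i) j * symbolSeminorm j (𝒟.m i θ) with hf
  have hpt : ∀ θ, ∏ i, symbolSeminorm (k i) (localisedSymbol ε₀ i (𝒟.m i θ)) ≤
      ∑ x ∈ Fintype.piFinset t, ∏ i, f i (x i) θ := by
    intro θ
    have hexp : ∏ i, ∑ j ∈ t i, f i j θ = ∑ x ∈ Fintype.piFinset t, ∏ i, f i (x i) θ :=
      Finset.prod_univ_sum t (fun i j => f i j θ)
    refine le_trans ?_ (le_of_eq hexp)
    refine Finset.prod_le_prod' fun i _ => ?_
    refine (symbolSeminorm_localisedSymbol_le hε hε5 i (𝒟.isComplexSymbol i θ) (k i)).trans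
      (le_of_eq (Finset.sum_congr rfl fun j _ => ?_))
    simp only [hf, leibnizConst]
    ring
  -- integrate: finite sum of (finite constant) × (a moment of `𝒟`)
  have hmeas : ∀ x : Fin 3 → ℕ, Measurable fun θ => ∏ i, f i (x i) θ := fun x =>
    Finset.measurable_prod _ fun i _ => (𝒟.measurable_symbolSeminorm i (x i)).const_mul _
  refine lt_of_le_of_lt (lintegral_mono hpt) ?_
  rw [lintegral_finsetSum _ fun x _ => hmeas x]
  refine ENNReal.sum_lt_top.2 fun x _ => ?_
  have hsplit : ∀ θ, ∏ i, f i (x i) θ =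
      (∏ i, leibnizConst ε₀ i (k i) (x i)) * (symbolSeminorm (x 0) (𝒟.m 0 θ) *
        symbolSeminorm (x 1) (𝒟.m 1 θ) * symbolSeminorm (x 2) (𝒟.m 2 θ)) := by
    intro θ
    simp only [hf, Fin.prod_univ_three]
    ring
  simp_rw [hsplit]
  rw [lintegral_const_mul _ (𝒟.measurable_symbolSeminorm_prod (x 0) (x 1) (x 2))]
  refine ENNReal.mul_lt_top (ENNReal.prod_lt_top fun i _ => leibnizConst_lt_top hε i _ _) ?_
  exact 𝒟.moment (x 0) (x 1) (x 2)

/-- **The single-scale datum** of §3.4: the finite measure space and the rotations of the datum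
`𝒟` of (3.9), dilation factors `1`, and the localised periodised symbols
`m̃_{i,ω} = Σₙ (m_{i,ω} χᵢ)((1+ε₀)^{-n} ·)` (for `0 < ε₀ ≤ 1/100`). [cite: Tao2016AveragedNS, §3.4 p. 17] -/
def singleScale (ε₀ : ℝ) (hε : 0 < ε₀) (hε1 : ε₀ ≤ 1 / 100) : ComplexAveragingDatum where
  Ω := 𝒟.Ω
  μ := 𝒟.μ
  m i θ := localisedSymbol ε₀ i (𝒟.m i θ)
  R := 𝒟.R
  lam _ _ := 1
  isComplexSymbol i θ :=
    isComplexSymbol_localisedSymbol hε (hε1.trans (by norm_num)) i (𝒟.isComplexSymbol i θ)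
  det_R := 𝒟.det_R
  lam_pos _ _ := one_pos
  lam_bdd := ⟨1, fun _ _ => by simp⟩
  moment k₁ k₂ k₃ := by
    have h := 𝒟.lintegral_localisedSymbol_lt_top hε (hε1.trans (by norm_num)) ![k₁, k₂, k₃]
    simpa only [Fin.prod_univ_three, Matrix.cons_val_zero, Matrix.cons_val_one,
      Matrix.cons_val] using h
  measurable_m i ξ hξ :=
    measurable_localisedSymbol hε (hε1.trans (by norm_num)) i (fun ζ hζ => 𝒟.measurable_m i ζ hζ) hξ
  measurable_R := 𝒟.measurable_R
  measurable_lam _ := measurable_const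

section SingleScale

variable {ε₀ : ℝ}

/-- The symbols of the single-scale datum are `L^∞`. [folklore] -/
theorem memLp_localisedSymbol (hε : 0 < ε₀) (hε1 : ε₀ ≤ 1 / 100) (i : Fin 3) (θ : 𝒟.Ω) :
    MemLp (localisedSymbol ε₀ i (𝒟.m i θ)) ∞ (volume : Measure ℝ³) :=
  ((𝒟.singleScale ε₀ hε hε1).isComplexSymbol i θ).memLp_top

/-- **The slots of the single-scale datum**: `A'_{i,ω} = m̃_{i,ω}(D) Rot_{R_{i,ω}}` (no dilation). [cite: Tao2016AveragedNS, §3.4 p. 17] -/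
theorem singleScale_slot (hε : 0 < ε₀) (hε1 : ε₀ ≤ 1 / 100) (i : Fin 3) (θ : 𝒟.Ω) (U : L2C) :
    (𝒟.singleScale ε₀ hε hε1).slot i θ U =
      fourierMultiplier ((𝒟.memLp_localisedSymbol hε hε1 i θ).toLp _) (rot (𝒟.R i θ) U) := by
  show fourierMultiplier _ (rot (𝒟.R i θ) (dil 1 U)) = _
  rw [dil_one]
  rfl

/-- **The Fourier side of the single-scale slots**: `𝓕(A'_{i,ω}U)(ξ) = m̃_{i,ω}(ξ) R_ℂ Û(R⁻¹ξ)` a.e. [cite: Tao2016AveragedNS, §3.4 p. 17] -/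
theorem fourierFn_singleScale_slot (hε : 0 < ε₀) (hε1 : ε₀ ≤ 1 / 100) (i : Fin 3) (θ : 𝒟.Ω) (U : L2C) :
    fourierFn ((𝒟.singleScale ε₀ hε hε1).slot i θ U) =ᵐ[volume] fun ξ =>
      localisedSymbol ε₀ i (𝒟.m i θ) ξ • rotMat (𝒟.R i θ) (fourierFn U ((𝒟.R i θ).symm ξ)) := by
  rw [𝒟.singleScale_slot hε hε1]
  filter_upwards [fourierFn_fourierMultiplier_toLp (𝒟.memLp_localisedSymbol hε hε1 i θ)
    (rot (𝒟.R i θ) U), fourierFn_rot (𝒟.R i θ) U] with ξ h1 h2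
  rw [h1, h2]

/-- **The single-scale slots commute with the dilations `Dil_{(1+ε₀)^{-n}}`**:
`A'_{i,ω} Dil = Dil A'_{i,ω}` (rotations commute with dilations, and `Dil_c m̃(D) = m̃(c⁻¹·)(D) Dil_c`
with `m̃((1+ε₀)ⁿ ·) = m̃` by periodicity). [cite: Tao2016AveragedNS, §3.4 p. 17] -/
theorem singleScale_slot_dil (hε : 0 < ε₀) (hε1 : ε₀ ≤ 1 / 100) (i : Fin 3) (θ : 𝒟.Ω) (n : ℤ) (U : L2C) :
    (𝒟.singleScale ε₀ hε hε1).slot i θ (dil ((1 + ε₀) ^ n)⁻¹ U) =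
      dil ((1 + ε₀) ^ n)⁻¹ ((𝒟.singleScale ε₀ hε hε1).slot i θ U) := by
  have hq : 0 < 1 + ε₀ := by linarith
  have hc : 0 < ((1 + ε₀) ^ n)⁻¹ := inv_pos.2 (zpow_pos hq n)
  have hm := 𝒟.memLp_localisedSymbol hε hε1 i θ
  -- the dilated symbol is the symbol itself (periodicity)
  have hper : (fun ξ => localisedSymbol ε₀ i (𝒟.m i θ) ((((1 + ε₀) ^ n)⁻¹)⁻¹ • ξ)) =
      localisedSymbol ε₀ i (𝒟.m i θ) := by
    funext ξ
    rw [inv_inv, localisedSymbol_zpow_smul hε]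
  have hmc : MemLp (fun ξ => localisedSymbol ε₀ i (𝒟.m i θ) ((((1 + ε₀) ^ n)⁻¹)⁻¹ • ξ)) ∞
      (volume : Measure ℝ³) := by
    rw [hper]
    exact hm
  have htoLp : hmc.toLp _ = hm.toLp _ := MemLp.toLp_congr _ _ (Eventually.of_forall fun ξ => by
    rw [hper])
  rw [𝒟.singleScale_slot hε hε1, 𝒟.singleScale_slot hε hε1, dil_fourierMultiplier hc hm hmc, htoLp,
    dil_rot]

end SingleScale

/-! ### The original datum on truncated fields -/

/-- **The Fourier side of a slot of the dilation-free datum of (3.9) on a truncated field**: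
`𝓕(A_{i,ω}(χᵢ(D)U))(ξ) = m_{i,ω}(ξ) χᵢ(ξ) R_ℂ Û(R⁻¹ξ)` a.e. (`χᵢ` is radial, so `χᵢ(D)` commutes
with the rotation). [cite: Tao2016AveragedNS, §3.4 p. 17] -/
theorem fourierFn_slot_slotCutoff (hlam : ∀ i θ, 𝒟.lam i θ = 1) {ε₀ : ℝ} (hε : 0 < ε₀) (i : Fin 3)
    (θ : 𝒟.Ω) (U : L2C) :
    fourierFn (𝒟.slot i θ (fourierMultiplier (slotCutoffLp hε i) U)) =ᵐ[volume] fun ξ =>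
      (𝒟.m i θ ξ * slotCutoff ε₀ i ξ) • rotMat (𝒟.R i θ) (fourierFn U ((𝒟.R i θ).symm ξ)) := by
  have hslot : 𝒟.slot i θ (fourierMultiplier (slotCutoffLp hε i) U) =
      fourierMultiplier (((𝒟.isComplexSymbol i θ).memLp_top).toLp _)
        (rot (𝒟.R i θ) (fourierMultiplier (slotCutoffLp hε i) U)) := by
    show fourierMultiplier _ (rot (𝒟.R i θ) (dil (𝒟.lam i θ) _)) = _
    rw [hlam, dil_one]
    rfl
  rw [hslot]
  have hχ : fourierFn (fourierMultiplier (slotCutoffLp hε i) U) =ᵐ[volume] fun ξ =>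
      slotCutoff ε₀ i ξ • fourierFn U ξ :=
    fourierFn_fourierMultiplier_toLp _ U
  filter_upwards [fourierFn_fourierMultiplier_toLp ((𝒟.isComplexSymbol i θ).memLp_top)
    (rot (𝒟.R i θ) (fourierMultiplier (slotCutoffLp hε i) U)),
    fourierFn_rot (𝒟.R i θ) (fourierMultiplier (slotCutoffLp hε i) U),
    (𝒟.R i θ).symm.measurePreserving.quasiMeasurePreserving.ae_eq hχ] with ξ h1 h2 h3
  simp only [Function.comp_apply] at h3
  rw [h1, h2, h3, map_smul, smul_smul, slotCutoff_linearIsometryEquiv]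

/-- **Symbol surgery for `B_{η,ρ,0}`** (the vanishing of the cross terms, §3.4): for the
dilation-free datum `𝒟` of (3.9) and `0 < ε₀ ≤ 1/100`,
`B_{η,ρ,0}(A_{1,ω}χ₁(D)U, A_{2,ω}χ₂(D)V, A_{3,ω}χ₃(D)X) = B_{η,ρ,0}(A'_{1,ω}U, A'_{2,ω}V, A'_{3,ω}X)`:
the weight of `B_{η,ρ,0}` confines `ξⱼ` to the shells `| |ξⱼ| - |ξⱼ⁰| | < 30ε₀²`, on which
`m̃ⱼ = mⱼχⱼ`. [cite: Tao2016AveragedNS, §3.4 p. 17] -/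
theorem weightedForm_slot_localise (hlam : ∀ i θ, 𝒟.lam i θ = 1) {ε₀ : ℝ} (hε : 0 < ε₀)
    (hε1 : ε₀ ≤ 1 / 100) (θ : 𝒟.Ω) (U V X : L2C) :
    weightedForm (scaleWeight ε₀ 0) (𝒟.slot 0 θ (fourierMultiplier (slotCutoffLp hε 0) U))
        (𝒟.slot 1 θ (fourierMultiplier (slotCutoffLp hε 1) V))
        (𝒟.slot 2 θ (fourierMultiplier (slotCutoffLp hε 2) X)) =
      weightedForm (scaleWeight ε₀ 0) ((𝒟.singleScale ε₀ hε hε1).slot 0 θ U)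
        ((𝒟.singleScale ε₀ hε hε1).slot 1 θ V) ((𝒟.singleScale ε₀ hε hε1).slot 2 θ X) := by
  have hε5 : ε₀ ≤ 1 / 5 := hε1.trans (by norm_num)
  have hagree : ∀ (i : Fin 3) (Y : L2C), ∀ᵐ ξ ∂(volume : Measure ℝ³),
      ξ ∈ normShell ‖xi0 i‖ (30 * ε₀ ^ 2) →
        fourierFn (𝒟.slot i θ (fourierMultiplier (slotCutoffLp hε i) Y)) ξ =
          fourierFn ((𝒟.singleScale ε₀ hε hε1).slot i θ Y) ξ := by
    intro i Y
    filter_upwards [𝒟.fourierFn_slot_slotCutoff hlam hε i θ Y,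
      𝒟.fourierFn_singleScale_slot hε hε1 i θ Y] with ξ h1 h2 hξ
    rw [h1, h2, localisedSymbol_eq_of_mem_normShell hε hε1 i _ hξ]
  exact weightedForm_congr_on (fun p hp => scaleWeight_zero_regions' hε hε5 hp)
    (hagree 0 U) (hagree 1 V) (hagree 2 X)

/-! ### `⟨C_n(u,v), w⟩ = ∫_Ω ⟨B_{η,ρ,n}(A'_1 u, A'_2 v), A'_3 w⟩ dμ` -/

/-- **The `n`-th cascade term as an `Ω`-average of `B_{η,ρ,n}` at the single-scale slots**:
for the dilation-free datum `𝒟` realising (3.9), normalised profiles and `u, v, w ∈ H¹⁰_df ⊗ ℂ`,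
`⟨u, \overline{ψ_{1,n}}⟩⟨v, \overline{ψ_{2,n}}⟩⟨w, \overline{ψ_{3,n}}⟩ = ∫_Ω ⟨B_{η,ρ,n}(A'_{1,ω}u, A'_{2,ω}v), A'_{3,ω}w⟩ dμ`
(Tao: "equal to `-πi⟨C_{n}(u,v),w⟩` when `n₁=n₂=n₃`", the `-πi` being carried by `B_{η,ρ}`). [cite: Tao2016AveragedNS, §3.4 p. 17] -/
theorem cascadeTerm_eq_integral_singleScale (hlam : ∀ i θ, 𝒟.lam i θ = 1) {ε₀ : ℝ} (hε : 0 < ε₀)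
    (hε1 : ε₀ ≤ 1 / 100) {ψ : Fin 3 → 𝓢(ℝ³, ℂ³)} (hψ : NormalisedProfiles ε₀ ψ)
    (h𝒟 : ∀ u v w, MemH10dfC u → MemH10dfC v → MemH10dfC w →
      singleScaleForm (ψ 0) (ψ 1) (ψ 2) u v w = 𝒟.average (betaRhoZeroForm ε₀) u v w)
    {u v w : L2C} (hu : MemH10dfC u) (hv : MemH10dfC v) (hw : MemH10dfC w) (n : ℤ) :
    pairing u (conjL2 (cplxCascadeWavelet ε₀ (ψ 0) n)) * pairing v (conjL2 (cplxCascadeWavelet ε₀ (ψ 1) n)) *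
        pairing w (conjL2 (cplxCascadeWavelet ε₀ (ψ 2) n)) =
      ∫ θ, betaRhoScaleForm ε₀ n ((𝒟.singleScale ε₀ hε hε1).slot 0 θ u)
        ((𝒟.singleScale ε₀ hε hε1).slot 1 θ v) ((𝒟.singleScale ε₀ hε hε1).slot 2 θ w) ∂𝒟.μ := by
  have hq : 0 < 1 + ε₀ := by linarith
  have hc : 0 < ((1 + ε₀) ^ n)⁻¹ := inv_pos.2 (zpow_pos hq n)
  have hε' : ε₀ ≤ 1 := hε1.trans (by norm_num)
  -- `C_n(u,v,w) = C₀(Dil u, Dil v, Dil w)` …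
  rw [cascadeTerm_eq_singleScaleForm_dil hq]
  -- … `= C₀(χ₁(D) Dil u, χ₂(D) Dil v, χ₃(D) Dil w)` (the cut-offs are `1` on the balls of `ψ̂ⱼ`) …
  rw [← singleScaleForm_fourierMultiplier hψ (fun i => slotCutoffLp hε i)
    (fun j => slotCutoffLp_eq_one_on_ball hε hε' j)]
  -- … `= ∫_Ω B_{η,ρ,0}(A_1 χ₁(D) Dil u, …) dμ` by (3.9) …
  rw [h𝒟 _ _ _ ((hu.dil hc).fourierMultiplier _) ((hv.dil hc).fourierMultiplier _)
    ((hw.dil hc).fourierMultiplier _)]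
  unfold average
  refine integral_congr_ae (Eventually.of_forall fun θ => ?_)
  -- … and pointwise in `ω`: surgery, commutation with the dilations, scaling law.
  simp only
  rw [betaRhoZeroForm_eq_weightedForm, 𝒟.weightedForm_slot_localise hlam hε hε1,
    ← betaRhoZeroForm_eq_weightedForm, 𝒟.singleScale_slot_dil hε hε1, 𝒟.singleScale_slot_dil hε hε1,
    𝒟.singleScale_slot_dil hε hε1, ← betaRhoScaleForm_eq_dil hq]

/-! ### Summing over the scales -/

/-- The prefactors cancel: `(1+ε₀)^{5n/2} (1+ε₀)^{-5n/2} = 1`. [folklore] -/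
theorem cascade_prefactor_mul {ε₀ : ℝ} (hε : 0 < ε₀) (n : ℤ) :
    (((1 + ε₀) ^ ((5 : ℝ) * (n : ℝ) / 2) : ℝ) : ℂ) * (((1 + ε₀) ^ (-(5 : ℝ) * (n : ℝ) / 2) : ℝ) : ℂ) = 1 := by
  have hq : 0 < 1 + ε₀ := by linarith
  rw [← Complex.ofReal_mul, ← Real.rpow_add hq, show (5 : ℝ) * (n : ℝ) / 2 + -(5 : ℝ) * (n : ℝ) / 2 = 0 by ring,
    Real.rpow_zero, Complex.ofReal_one]

/-- `B_{η,ρ}` is homogeneous in its first field. [folklore] -/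
theorem betaRhoForm_smul₁ (ε₀ : ℝ) (a : ℂ) (U V X : L2C) :
    betaRhoForm ε₀ (a • U) V X = a * betaRhoForm ε₀ U V X := by
  rw [betaRhoForm_eq_weightedForm, betaRhoForm_eq_weightedForm, weightedForm_smul₁]
  ring

/-- **`⟨C(u,v), w⟩ = (1/(-πi)) ∫_Ω ⟨B_{η,ρ}(m̃₁(D)Rot u, m̃₂(D)Rot v), m̃₃(D)Rot w⟩ dμ`** ("Summing, we
see that …", §3.4), with the factor `1/(-πi)` absorbed into the first symbol: for the dilation-free
datum `𝒟` realising (3.9), normalised profiles, `0 < ε₀ ≤ 1/100` and `u, v, w ∈ H¹⁰_df ⊗ ℂ`, the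
complexified cascade form (3.6) is the complex average of `B_{η,ρ}` over the scaled single-scale
datum. The sum over `n` and the `Ω`-integral are exchanged by absolute convergence
(`tsum_lintegral_enorm_weightedForm_slot_lt_top`), and inside, `Σₙ (1+ε₀)^{5n/2} B_{η,ρ,n} = (1/(-πi)) B_{η,ρ}`
at the slots (`weightedForm_tsum`, `ρ η = Σₙ φₙ η`). [cite: Tao2016AveragedNS, §3.4 p. 17] -/
theorem cplxBasicCascadeForm_eq_average (hlam : ∀ i θ, 𝒟.lam i θ = 1) {ε₀ : ℝ} (hε : 0 < ε₀)
    (hε1 : ε₀ ≤ 1 / 100) {ψ : Fin 3 → 𝓢(ℝ³, ℂ³)} (hψ : NormalisedProfiles ε₀ ψ)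
    (h𝒟 : ∀ u v w, MemH10dfC u → MemH10dfC v → MemH10dfC w →
      singleScaleForm (ψ 0) (ψ 1) (ψ 2) u v w = 𝒟.average (betaRhoZeroForm ε₀) u v w)
    {u v w : L2C} (hu : MemH10dfC u) (hv : MemH10dfC v) (hw : MemH10dfC w) :
    cplxBasicCascadeForm ε₀ (ψ 0) (ψ 1) (ψ 2) u v w =
      ((𝒟.singleScale ε₀ hε hε1).scale (-(Real.pi * Complex.I))⁻¹).average (betaRhoForm ε₀) u v w := by
  have hε5 : ε₀ ≤ 1 / 5 := hε1.trans (by norm_num)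
  set 𝒟' := 𝒟.singleScale ε₀ hε hε1 with h𝒟'
  have hπ : -(Real.pi * Complex.I) ≠ 0 :=
    neg_ne_zero.2 (mul_ne_zero (Complex.ofReal_ne_zero.2 Real.pi_ne_zero) Complex.I_ne_zero)
  -- Step 1: each scale as an `Ω`-integral of the weighted form
  have hterm : ∀ n : ℤ, (((1 + ε₀) ^ ((5 : ℝ) * (n : ℝ) / 2) : ℝ) : ℂ) *
      (pairing u (conjL2 (cplxCascadeWavelet ε₀ (ψ 0) n)) *
        pairing v (conjL2 (cplxCascadeWavelet ε₀ (ψ 1) n)) *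
        pairing w (conjL2 (cplxCascadeWavelet ε₀ (ψ 2) n))) =
      ∫ θ, weightedForm (scaleWeight ε₀ n) (𝒟'.slot 0 θ u) (𝒟'.slot 1 θ v) (𝒟'.slot 2 θ w) ∂𝒟'.μ := by
    intro n
    rw [𝒟.cascadeTerm_eq_integral_singleScale hlam hε hε1 hψ h𝒟 hu hv hw n, ← integral_const_mul]
    refine integral_congr_ae (Eventually.of_forall fun θ => ?_)
    simp only
    rw [betaRhoScaleForm_eq_weightedForm, ← mul_assoc, cascade_prefactor_mul hε, one_mul]
  -- Step 2: exchange the sum over scales with the `Ω`-integral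
  have hF : ∀ n : ℤ, AEStronglyMeasurable (fun θ => weightedForm (scaleWeight ε₀ n)
      (𝒟'.slot 0 θ u) (𝒟'.slot 1 θ v) (𝒟'.slot 2 θ w)) 𝒟'.μ := fun n =>
    𝒟'.aestronglyMeasurable_weightedForm_slot (measurable_scaleWeight ε₀ n) u v w
  have hF' : ∑' n : ℤ, ∫⁻ θ, ‖weightedForm (scaleWeight ε₀ n) (𝒟'.slot 0 θ u) (𝒟'.slot 1 θ v)
      (𝒟'.slot 2 θ w)‖ₑ ∂𝒟'.μ ≠ ∞ :=
    ne_of_lt (𝒟'.tsum_lintegral_enorm_weightedForm_slot_lt_top (measurable_scaleWeight ε₀)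
      (tsum_enorm_scaleWeight_le_one hε hε5) w hu.1 hv.1)
  unfold cplxBasicCascadeForm
  simp_rw [hterm]
  rw [← integral_tsum hF hF']
  -- Step 3: resum the scales inside and absorb the factor `1/(-πi)`
  unfold average
  refine integral_congr_ae (Eventually.of_forall fun θ => ?_)
  simp only
  have hint : Integrable (eulerIntegrand (𝒟'.slot 0 θ u) (𝒟'.slot 1 θ v) (𝒟'.slot 2 θ w)) :=
    𝒟'.integrable_eulerIntegrand_slot w θ hu.1 hv.1
  rw [← weightedForm_tsum (measurable_scaleWeight ε₀) (tsum_enorm_scaleWeight_le_one hε hε5) hint,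
    show (fun p : ℝ³ × ℝ³ => ∑' n : ℤ, scaleWeight ε₀ n p) = rhoWeight ε₀ from
      funext fun p => (rhoWeight_eq_tsum ε₀ p).symm,
    𝒟'.scale_slot_zero, 𝒟'.scale_slot_of_ne_zero _ (show (1 : Fin 3) ≠ 0 by decide),
    𝒟'.scale_slot_of_ne_zero _ (show (2 : Fin 3) ≠ 0 by decide), betaRhoForm_smul₁,
    betaRhoForm_eq_weightedForm, ← mul_assoc, inv_mul_cancel₀ hπ, one_mul]

end ComplexAveragingDatum

/-! ### Discharge of `cascade_of_singleScale` -/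

/-- **Tao 2016, §3.4, proved** (`cascade_of_singleScale_holds`): there is an absolute threshold
(`ε₁ = 1/100`) such that for `0 < ε₀ ≤ ε₁` and normalised profiles (3.7), if the single-scale piece
`C₀` (3.8) is a dilation-free complex average (3.9) of `B_{η,ρ,0}`, then the complexified basic
cascade operator `C` (3.6) is a complex average (Def. 3.4) of `B_{η,ρ}`. [cite: Tao2016AveragedNS, §3.4 pp. 16–17] -/
theorem cascade_of_singleScale_holds : cascade_of_singleScale := by
  refine ⟨1 / 100, by norm_num, fun ε₀ hε hε1 ψ hψ hC₀ => ?_⟩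
  obtain ⟨𝒟, hlam, h𝒟⟩ := hC₀
  exact ⟨(𝒟.singleScale ε₀ hε hε1).scale (-(Real.pi * Complex.I))⁻¹, fun u v w hu hv hw =>
    𝒟.cplxBasicCascadeForm_eq_average hlam hε hε1 hψ h𝒟 hu hv hw⟩

end Literature.Analysis.FluidPDE.Tao2016
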